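import Summits.CriticalPhenomena.PercolationContinuityZ3.Theorems.PercNearOneGluingNoHeavyLowerTailSahiCombTriWGeneral

/-!
# `TRI_W(a)`: the TOP-FIBRE inequality (the first rung of the top-down filtration of the two-copy problem), all `a`, unconditional

Support file of the one-cut programme (crux `NoHeavyLowerTail`, stmt-CriticalPhenomena-4575; cell `prim-masterthm`, seat P5 gen 11;
report `P5-LORENTZIAN-TEST.md` §16).

Write the one-cube functional of `…SahiCombTriWGeneral` as `TRI_W(a)(P) = Σ_x T_x(P)` with the summand regrouped so that every token sits at
its own index (`E`-demands `G x ∩ refl (F xᶜ)` counted at `x`, not at `xᶜ`):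
`T_x(P) = 2·#(P ∩ F x ∩ G x) + #(P ∩ refl (F x) ∩ refl (G xᶜ)) − #(P ∩ G x ∩ refl (F xᶜ)) − #(P ∩ F x ∩ refl (G xᶜ)) − #(P ∩ refl (F x ∩ G x))`
(`topTerm`; `Σ_x topTerm = triW`, `sum_topTerm_eq_triW`).  Census (report §16.2, exhaustive `(n,a) = (2,1),(2,2),(1,2),(1,3)`, sampled
`(3,1),(3,2),(2,3)`): for every UP-SET `J` of the index cube, `Σ_{x ∈ J} T_x(P) ≥ 0` (conjecture (JP); the bottom-face sums are often negative).
This file proves the first rung `J = {univ}` for EVERY `a`, in the sharper four-demand form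

  `#(P ∩ B₁ ∩ refl A₀) + #(P ∩ A₁ ∩ refl B₀) + #(P ∩ refl (A₁ ∩ (B₁ \ B₀))) + #(P ∩ refl ((A₁ \ A₀) ∩ B₁)) ≤ 2 · #(P ∩ A₁ ∩ B₁)`

for up-sets `P, A₀ ⊆ A₁, B₀ ⊆ B₁` (`topFibre_le`): two instances of the three-up-set theorem `FiveUpSet.threeUpSetIneq_holds`
(`…SahiCombFiveUpSetProof`), one for the flag `A₀ ⊆ A₁` inside `B₁` and one for `B₀ ⊆ B₁` inside `A₁`.  Consequences:
`topTerm P F G univ ≥ #(P ∩ refl ((F univ \ F ∅) ∩ G univ)) ≥ 0` for monotone families (`topTerm_univ_nonneg`), and the `x = univ` summand of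
`triW` itself is non-negative (`triWTerm_univ_nonneg`).
HONEST LABEL: one regrouping identity and one unconditional inequality (a corollary of the five-up-set theorem); the conjecture (JP) for general
up-sets `J` and `TriWIneq` (`J = univ`-cube) remain OPEN and are NOT proved here. [this work]
-/

namespace Summit.CriticalPhenomena.PercolationContinuityZ3.Theorems

namespace FiveUpSet

open Finset

variable {β γ : Type} [DecidableEq β] [Fintype β] [DecidableEq γ] [Fintype γ]

/-! ### The top-fibre inequality for two flags -/

omit [DecidableEq β] [Fintype β] in
/-- **Top-fibre inequality** (all cubes, unconditional): for up-sets `P`, `A₀ ⊆ A₁`, `B₀ ⊆ B₁` of `Finset γ`,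
`#(P ∩ B₁ ∩ refl A₀) + #(P ∩ A₁ ∩ refl B₀) + #(P ∩ refl (A₁ ∩ (B₁ \ B₀))) + #(P ∩ refl ((A₁ \ A₀) ∩ B₁)) ≤ 2 · #(P ∩ A₁ ∩ B₁)`.
Proof: the three-up-set theorem for `(P; A₀ ⊆ A₁; B₁)` gives `#(P ∩ refl A₀ ∩ B₁) + #(P ∩ refl (A₁ \ A₀) ∩ refl B₁) ≤ #(P ∩ A₁ ∩ B₁)`, and for
`(P; B₀ ⊆ B₁; A₁)` gives `#(P ∩ refl B₀ ∩ A₁) + #(P ∩ refl (B₁ \ B₀) ∩ refl A₁) ≤ #(P ∩ B₁ ∩ A₁)`; add. [this work] -/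
theorem topFibre_le (P A₀ A₁ B₀ B₁ : Finset (Finset γ)) (hP : IsUpperSet (P : Set (Finset γ)))
    (hA₀ : IsUpperSet (A₀ : Set (Finset γ))) (hA₁ : IsUpperSet (A₁ : Set (Finset γ)))
    (hB₀ : IsUpperSet (B₀ : Set (Finset γ))) (hB₁ : IsUpperSet (B₁ : Set (Finset γ))) (hA : A₀ ⊆ A₁) (hB : B₀ ⊆ B₁) :
    (P ∩ B₁ ∩ refl A₀).card + (P ∩ A₁ ∩ refl B₀).card + (P ∩ refl (A₁ ∩ (B₁ \ B₀))).card
      + (P ∩ refl ((A₁ \ A₀) ∩ B₁)).card ≤ 2 * (P ∩ A₁ ∩ B₁).card := by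
  have h1 := threeUpSetIneq_holds γ P A₀ A₁ B₁ hP hA₀ hA₁ hB₁ hA
  have h2 := threeUpSetIneq_holds γ P B₀ B₁ A₁ hP hB₀ hB₁ hA₁ hB
  have e1 : P ∩ refl A₀ ∩ B₁ = P ∩ B₁ ∩ refl A₀ := by
    rw [inter_assoc, inter_assoc, inter_comm (refl A₀)]
  have e2 : P ∩ refl (A₁ \ A₀) ∩ refl B₁ = P ∩ refl ((A₁ \ A₀) ∩ B₁) := by
    rw [refl_inter, inter_assoc]
  have e3 : P ∩ refl B₀ ∩ A₁ = P ∩ A₁ ∩ refl B₀ := by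
    rw [inter_assoc, inter_assoc, inter_comm (refl B₀)]
  have e4 : P ∩ refl (B₁ \ B₀) ∩ refl A₁ = P ∩ refl (A₁ ∩ (B₁ \ B₀)) := by
    rw [refl_inter, inter_assoc, inter_comm (refl (B₁ \ B₀))]
  have e5 : P ∩ B₁ ∩ A₁ = P ∩ A₁ ∩ B₁ := by
    rw [inter_assoc, inter_assoc, inter_comm B₁]
  rw [e1, e2] at h1
  rw [e3, e4, e5] at h2
  omega

omit [DecidableEq β] [Fintype β] in
/-- The top-fibre inequality in netted form: `#(P ∩ B₁ ∩ refl A₀) + #(P ∩ A₁ ∩ refl B₀) + #(P ∩ refl (A₁ ∩ B₁)) ≤ 2·#(P ∩ A₁ ∩ B₁) + #(P ∩ refl A₁ ∩ refl B₀)`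
(the reflected supply box `refl (A₁ ∩ B₁)` splits as `refl (A₁ ∩ (B₁ \ B₀)) ⊔ refl (A₁ ∩ B₀)`). [this work] -/
theorem topFibre_le' (P A₀ A₁ B₀ B₁ : Finset (Finset γ)) (hP : IsUpperSet (P : Set (Finset γ)))
    (hA₀ : IsUpperSet (A₀ : Set (Finset γ))) (hA₁ : IsUpperSet (A₁ : Set (Finset γ)))
    (hB₀ : IsUpperSet (B₀ : Set (Finset γ))) (hB₁ : IsUpperSet (B₁ : Set (Finset γ))) (hA : A₀ ⊆ A₁) (hB : B₀ ⊆ B₁) :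
    (P ∩ B₁ ∩ refl A₀).card + (P ∩ A₁ ∩ refl B₀).card + (P ∩ refl (A₁ ∩ B₁)).card
      ≤ 2 * (P ∩ A₁ ∩ B₁).card + (P ∩ refl A₁ ∩ refl B₀).card := by
  have h := topFibre_le P A₀ A₁ B₀ B₁ hP hA₀ hA₁ hB₀ hB₁ hA hB
  -- split `P ∩ refl (A₁ ∩ B₁)` along `B₀`
  have hsplit : (P ∩ refl (A₁ ∩ B₁)).card
      = (P ∩ refl (A₁ ∩ (B₁ \ B₀))).card + (P ∩ refl A₁ ∩ refl B₀).card := by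
    have hu : P ∩ refl (A₁ ∩ B₁) = (P ∩ refl (A₁ ∩ (B₁ \ B₀))) ∪ (P ∩ refl A₁ ∩ refl B₀) := by
      ext s
      simp only [mem_inter, mem_union, mem_refl, mem_sdiff]
      constructor
      · rintro ⟨hs, hA1, hB1⟩
        by_cases h0 : sᶜ ∈ B₀
        · exact Or.inr ⟨⟨hs, hA1⟩, h0⟩
        · exact Or.inl ⟨hs, hA1, hB1, h0⟩
      · rintro (⟨hs, hA1, hB1, _⟩ | ⟨⟨hs, hA1⟩, h0⟩)
        · exact ⟨hs, hA1, hB1⟩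
        · exact ⟨hs, hA1, hB h0⟩
    have hd : Disjoint (P ∩ refl (A₁ ∩ (B₁ \ B₀))) (P ∩ refl A₁ ∩ refl B₀) := by
      rw [disjoint_left]
      intro s h1 h2
      simp only [mem_inter, mem_refl, mem_sdiff] at h1 h2
      exact h1.2.2.2 h2.2
    rw [hu, card_union_of_disjoint hd]
  omega

/-! ### The regrouped summand `T_x` and the top rung of the filtration -/

/-- The summand of `TRI_W(a)` with every token at its own index (report §16.2):
`topTerm P F G x = 2·#(P ∩ F x ∩ G x) + #(P ∩ refl (F x) ∩ refl (G xᶜ)) − #(P ∩ G x ∩ refl (F xᶜ)) − #(P ∩ F x ∩ refl (G xᶜ)) − #(P ∩ refl (F x ∩ G x))`.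
It differs from `triWTerm P F G x` only in where the `E`-demand is booked (`G x ∩ refl (F xᶜ)` here versus `refl (F x) ∩ G xᶜ` there);
the sums over `x` agree (`sum_topTerm_eq_triW`). [this work] -/
def topTerm (P : Finset (Finset γ)) (F G : Finset β → Finset (Finset γ)) (x : Finset β) : ℤ :=
  2 * ((P ∩ F x ∩ G x).card : ℤ) + (P ∩ refl (F x) ∩ refl (G xᶜ)).card - (P ∩ G x ∩ refl (F xᶜ)).card
    - (P ∩ F x ∩ refl (G xᶜ)).card - (P ∩ refl (F x ∩ G x)).card

/-- `Σ_x topTerm P F G x = triW P F G` (re-index the `E`-demands by `x ↦ xᶜ`). [this work] -/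
theorem sum_topTerm_eq_triW (P : Finset (Finset γ)) (F G : Finset β → Finset (Finset γ)) :
    ∑ x : Finset β, topTerm P F G x = triW P F G := by
  unfold triW
  -- the common part of the two summands
  set c : Finset β → ℤ := fun x =>
    2 * ((P ∩ F x ∩ G x).card : ℤ) + (P ∩ refl (F x) ∩ refl (G xᶜ)).card - (P ∩ F x ∩ refl (G xᶜ)).card
      - (P ∩ refl (F x) ∩ refl (G x)).card with hc
  have hD3 : ∀ x : Finset β, (P ∩ refl (F x ∩ G x)).card = (P ∩ refl (F x) ∩ refl (G x)).card := by
    intro x; rw [refl_inter, inter_assoc]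
  have htop : ∀ x, topTerm P F G x = c x - ((P ∩ G x ∩ refl (F xᶜ)).card : ℤ) := by
    intro x; simp only [topTerm, hc, hD3]; ring
  have htri : ∀ x, triWTerm P F G x = c x - ((P ∩ refl (F x) ∩ G xᶜ).card : ℤ) := by
    intro x; simp only [triWTerm, hc]; ring
  have hre : ∑ x : Finset β, ((P ∩ G x ∩ refl (F xᶜ)).card : ℤ)
      = ∑ x : Finset β, ((P ∩ refl (F x) ∩ G xᶜ).card : ℤ) := by
    refine Fintype.sum_equiv (complEquiv β) _ _ (fun x => ?_)
    show ((P ∩ G x ∩ refl (F xᶜ)).card : ℤ) = ((P ∩ refl (F xᶜ) ∩ G xᶜᶜ).card : ℤ)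
    rw [compl_compl, inter_assoc, inter_assoc, inter_comm (G x)]
  simp only [htop, htri, sum_sub_distrib, hre]

/-- **The top rung of (JP), all `a`, unconditional**: for monotone families of up-sets and an up-set `P`,
`#(P ∩ refl ((F univ \ F ∅) ∩ G univ)) ≤ topTerm P F G univ`; in particular `0 ≤ topTerm P F G univ`.  (`univᶜ = ∅`; this is
`topFibre_le` for the flags `F ∅ ⊆ F univ`, `G ∅ ⊆ G univ`.) [this work] -/
theorem topTerm_univ_ge (P : Finset (Finset γ)) (F G : Finset β → Finset (Finset γ))
    (hP : IsUpperSet (P : Set (Finset γ))) (hF : ∀ x, IsUpperSet (F x : Set (Finset γ)))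
    (hG : ∀ x, IsUpperSet (G x : Set (Finset γ))) (hFm : Monotone F) (hGm : Monotone G) :
    ((P ∩ refl ((F univ \ F ∅) ∩ G univ)).card : ℤ) ≤ topTerm P F G univ := by
  have h := topFibre_le P (F ∅) (F univ) (G ∅) (G univ) hP (hF ∅) (hF univ) (hG ∅) (hG univ)
    (hFm (empty_subset _)) (hGm (empty_subset _))
  unfold topTerm
  rw [compl_univ]
  have hD3 : (P ∩ refl (F univ ∩ G univ)).card
      = (P ∩ refl (F univ ∩ (G univ \ G ∅))).card + (P ∩ refl (F univ) ∩ refl (G ∅)).card := by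
    have hu : P ∩ refl (F univ ∩ G univ)
        = (P ∩ refl (F univ ∩ (G univ \ G ∅))) ∪ (P ∩ refl (F univ) ∩ refl (G ∅)) := by
      ext s
      simp only [mem_inter, mem_union, mem_refl, mem_sdiff]
      constructor
      · rintro ⟨hs, hF1, hG1⟩
        by_cases h0 : sᶜ ∈ G ∅
        · exact Or.inr ⟨⟨hs, hF1⟩, h0⟩
        · exact Or.inl ⟨hs, hF1, hG1, h0⟩
      · rintro (⟨hs, hF1, hG1, _⟩ | ⟨⟨hs, hF1⟩, h0⟩)
        · exact ⟨hs, hF1, hG1⟩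
        · exact ⟨hs, hF1, hGm (empty_subset _) h0⟩
    have hd : Disjoint (P ∩ refl (F univ ∩ (G univ \ G ∅))) (P ∩ refl (F univ) ∩ refl (G ∅)) := by
      rw [disjoint_left]
      intro s h1 h2
      simp only [mem_inter, mem_refl, mem_sdiff] at h1 h2
      exact h1.2.2.2 h2.2
    rw [hu, card_union_of_disjoint hd]
  rw [hD3]
  push_cast
  omega

/-- `0 ≤ topTerm P F G univ` for monotone families of up-sets (the case `J = {univ}` of (JP)). [this work] -/
theorem topTerm_univ_nonneg (P : Finset (Finset γ)) (F G : Finset β → Finset (Finset γ))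
    (hP : IsUpperSet (P : Set (Finset γ))) (hF : ∀ x, IsUpperSet (F x : Set (Finset γ)))
    (hG : ∀ x, IsUpperSet (G x : Set (Finset γ))) (hFm : Monotone F) (hGm : Monotone G) :
    0 ≤ topTerm P F G univ :=
  le_trans (by positivity) (topTerm_univ_ge P F G hP hF hG hFm hGm)

/-- The `x = univ` summand of `triW` itself is non-negative for monotone families of up-sets:
`triWTerm P F G univ = 2·#(P ∩ U₁) − #(P ∩ refl (F univ) ∩ G ∅) − #(P ∩ F univ ∩ refl (G ∅)) − #(P ∩ refl (F univ) ∩ refl (G univ)) + #(P ∩ refl (F univ) ∩ refl (G ∅)) ≥ 0`,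
by `topFibre_le` for the second, third and fourth terms and Kleitman's lemma inside `P ∩ G ∅` for the first. [this work] -/
theorem triWTerm_univ_nonneg (P : Finset (Finset γ)) (F G : Finset β → Finset (Finset γ))
    (hP : IsUpperSet (P : Set (Finset γ))) (hF : ∀ x, IsUpperSet (F x : Set (Finset γ)))
    (hG : ∀ x, IsUpperSet (G x : Set (Finset γ))) (hFm : Monotone F) (hGm : Monotone G) :
    0 ≤ triWTerm P F G univ := by
  have hA : F ∅ ⊆ F univ := hFm (empty_subset _)
  have hB : G ∅ ⊆ G univ := hGm (empty_subset _)
  -- the `B`-flag three-up-set instance: `#(P ∩ refl B₀ ∩ A₁) + #(P ∩ refl (B₁ \ B₀) ∩ refl A₁) ≤ #(P ∩ B₁ ∩ A₁)`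
  have h2 := threeUpSetIneq_holds γ P (G ∅) (G univ) (F univ) hP (hG ∅) (hG univ) (hF univ) hB
  -- Kleitman inside the up-set `P ∩ G ∅`: `#(P ∩ G ∅ ∩ refl (F univ)) ≤ #(P ∩ G ∅ ∩ F univ) ≤ #(P ∩ F univ ∩ G univ)`
  have hPG : IsUpperSet ((P ∩ G ∅ : Finset (Finset γ)) : Set (Finset γ)) := by
    rw [coe_inter]; exact hP.inter (hG ∅)
  have hk : (P ∩ G ∅ ∩ refl (F univ)).card ≤ (P ∩ G ∅ ∩ F univ).card := card_inter_refl_le hPG (hF univ)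
  have hmono : (P ∩ G ∅ ∩ F univ).card ≤ (P ∩ F univ ∩ G univ).card := by
    refine card_le_card ?_
    intro s hs
    simp only [mem_inter] at hs ⊢
    exact ⟨⟨hs.1.1, hs.2⟩, hB hs.1.2⟩
  -- bookkeeping
  have e1 : P ∩ refl (F univ) ∩ G ∅ = P ∩ G ∅ ∩ refl (F univ) := by
    rw [inter_assoc, inter_assoc, inter_comm (refl (F univ))]
  have e3 : P ∩ refl (G ∅) ∩ F univ = P ∩ F univ ∩ refl (G ∅) := by
    rw [inter_assoc, inter_assoc, inter_comm (refl (G ∅))]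
  have e5 : P ∩ G univ ∩ F univ = P ∩ F univ ∩ G univ := by
    rw [inter_assoc, inter_assoc, inter_comm (G univ)]
  have hsplit : (P ∩ refl (F univ) ∩ refl (G univ)).card
      = (P ∩ refl (G univ \ G ∅) ∩ refl (F univ)).card + (P ∩ refl (F univ) ∩ refl (G ∅)).card := by
    have hu : P ∩ refl (F univ) ∩ refl (G univ)
        = (P ∩ refl (G univ \ G ∅) ∩ refl (F univ)) ∪ (P ∩ refl (F univ) ∩ refl (G ∅)) := by
      ext s
      simp only [mem_inter, mem_union, mem_refl, mem_sdiff]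
      constructor
      · rintro ⟨⟨hs, hF1⟩, hG1⟩
        by_cases h0 : sᶜ ∈ G ∅
        · exact Or.inr ⟨⟨hs, hF1⟩, h0⟩
        · exact Or.inl ⟨⟨hs, hG1, h0⟩, hF1⟩
      · rintro (⟨⟨hs, hG1, _⟩, hF1⟩ | ⟨⟨hs, hF1⟩, h0⟩)
        · exact ⟨⟨hs, hF1⟩, hG1⟩
        · exact ⟨⟨hs, hF1⟩, hB h0⟩
    have hd : Disjoint (P ∩ refl (G univ \ G ∅) ∩ refl (F univ)) (P ∩ refl (F univ) ∩ refl (G ∅)) := by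
      rw [disjoint_left]
      intro s h1 h3
      simp only [mem_inter, mem_refl, mem_sdiff] at h1 h3
      exact h1.1.2.2 h3.2
    rw [hu, card_union_of_disjoint hd]
  unfold triWTerm
  rw [compl_univ, e1, hsplit]
  rw [e3, e5] at h2
  push_cast
  omega

end FiveUpSet

end Summit.CriticalPhenomena.PercolationContinuityZ3.Theorems
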